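import Mathlib.RingTheory.PowerSeries.Substitution
import Mathlib.RingTheory.PowerSeries.Expand
import Mathlib.RingTheory.PowerSeries.Derivative
import Mathlib.RingTheory.PowerSeries.Trunc
import Mathlib.RingTheory.PowerSeries.Order
import Mathlib.RingTheory.PowerSeries.NoZeroDivisors
import Mathlib.Algebra.Polynomial.Taylor
import Mathlib.Algebra.CharP.Frobenius
import Mathlib.Algebra.CharP.Quotient
import Mathlib.RingTheory.Ideal.Quotient.Basic
import Mathlib.NumberTheory.Padics.RingHoms
import Mathlib.RingTheory.WittVector.Identities
import Mathlib.RingTheory.WittVector.Domain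
import Mathlib.FieldTheory.Perfect
import Literature.NumberTheory.EllipticCurves.DivisionPolynomialFormalMulProofs
import Literature.NumberTheory.EllipticCurves.FormalGroupHasseInvariantProofs
import Literature.RingTheory.FormalGroups.FunctionalEquationIntegrality
import Literature.NumberTheory.EllipticCurves.FormalGroupMultiplicationUniversalProofs
import Literature.NumberTheory.EllipticCurves.FormalGroupLogHomProofs
import Literature.RingTheory.FormalGroups.HondaTypeTransport
import Literature.NumberTheory.EllipticCurves.FormalMulTwoSecondCoeffProofs
import Mathlib.RingTheory.WittVector.FrobeniusFractionField
import Mathlib.RingTheory.WittVector.Compare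
import Mathlib.FieldTheory.Finite.Basic
import Literature.NumberTheory.EllipticCurves.FormalLogExpBaseChangeProofs
import Summits.BirchSwinnertonDyer.BirchSwinnertonDyer.Theorems.EisensteinDepletionAtTwoStarGO2KEtaKernelA
import HarnessLib

/-!
# THEOREM K (the 2-adic Kummer class law for `z²(x(z) − x₀)`), kernel formalisation — KEtaKernelB
(crux `StarGO2Sigma`, stmt-BirchSwinnertonDyer-27046; line kummer, research stub `stub_discrepancyCover`)

Planner bsd-rank2-p2 GEN 36–37's K-UNIV / K-ETA kernel files (HOME/p2/g37/lean, memo K-UNIV.md; monolith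
`KummerTheoremK_full.lean`, lean rc 0, 0 sorries), landed by the lead star-p1 GEN 12 in ≤ 400-line parts, verbatim except for
file packaging.  This part: THEOREM K kernel, part B: the chain rule modulo 4 (`chainRule`), cancellation (`map_delta_eq_zero_of_sq_mul_eq_sq`), the abstract transfer `kummerClass_transfer` (THEOREM K core) and the instances (ℤ₂, id, 𝔽₂), (𝕎(k), Frobenius, k).
Nothing here reads `r_an`; `StarGO2Sigma` / E1M / BSD are NOT proved by this file.
-/

set_option linter.dupNamespace false
set_option linter.unusedSectionVars false
set_option autoImplicit false

noncomputable section

open PowerSeries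

namespace Summit.BirchSwinnertonDyer.BirchSwinnertonDyer.Theorems.DepletionAtTwo.KEta.Kernel

section ChainRule

variable {O : Type*} [CommRing O] {k : Type*} [CommRing k] [CharP k 2] {σ : O →+* O} {π : O →+* k}

/-- **The chain rule modulo `4` for the Dwork class.** With `φu = u² + 2δ`, `φz = z² + 2d`, `z(0) = 0`, and
`φ(u∘z) = (u∘z)² + 2δ′`:  `π_*δ′ = (π_*δ)∘z̄ + (ū′∘z̄)²·π_*d` (`ū = π_*u`, `z̄ = π_*z`).  Dividing by
`(ū∘z̄)²` this reads `D(u∘z) = (Du)∘z̄ + ((ū′/ū)∘z̄)²·d̄_z`.  Proof: `φ(u∘z) = (σ_*u)(z² + 2d)`; Taylor on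
the square-zero element `2d` of `(O/4)⟦X⟧`; `(σ_*u)(z²) = (φu)(z)`; and `(Frob_*ū)′(z̄²) = (ū′(z̄))²`.
[K-UNIV.md §2 (CR)] -/
theorem chainRule (h2r : ∀ a : O, 2 * a = 0 → a = 0) (hker : ∀ a : O, π a = 0 ↔ ∃ b : O, a = 2 * b) (hfrob : ∀ a : O, π (σ a) = π a ^ 2) {u z δ d δ' : O⟦X⟧} (hz : constantCoeff z = 0)
    (hu : phi σ u = u ^ 2 + 2 * δ) (hzφ : phi σ z = z ^ 2 + 2 * d)
    (h' : phi σ (u.subst z) = (u.subst z) ^ 2 + 2 * δ') :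
    δ'.map π = (δ.map π).subst (z.map π) + ((d⁄dX k (u.map π)).subst (z.map π)) ^ 2 * d.map π := by
  have hsz : HasSubst z := HasSubst.of_constantCoeff_zero' hz
  -- `d(0) = 0`
  have hd0 : constantCoeff d = 0 := by
    have h := congrArg constantCoeff hzφ
    rw [constantCoeff_phi, map_add, map_pow, hz, map_zero, zero_pow two_ne_zero, zero_add, map_mul,
      map_ofNat, eq_comm] at h
    exact h2r _ h
  -- Step 1: Taylor mod 4.  Work in `O₄ = O/(4)`.
  set I : Ideal O := Ideal.span {(4 : O)} with hI
  set π₄ : O →+* O ⧸ I := Ideal.Quotient.mk I with hπ₄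
  have h4 : π₄ 4 = 0 := Ideal.Quotient.eq_zero_iff_mem.mpr (Ideal.mem_span_singleton_self _)
  have hY0 : constantCoeff ((z ^ 2).map π₄) = 0 := by
    rw [← coeff_zero_eq_constantCoeff_apply, coeff_map, coeff_zero_eq_constantCoeff_apply, map_pow, hz,
      zero_pow two_ne_zero, map_zero]
  have hE0 : constantCoeff ((2 * d).map π₄) = 0 := by
    rw [← coeff_zero_eq_constantCoeff_apply, coeff_map, coeff_zero_eq_constantCoeff_apply, map_mul, hd0,
      mul_zero, map_zero]
  have hE2 : (2 * d).map π₄ * (2 * d).map π₄ = 0 := by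
    rw [← map_mul, show (2 * d) * (2 * d) = C (4 : O) * (d * d) by
      rw [show (4 : O) = 2 * 2 by norm_num, map_mul, map_ofNat]; ring, map_mul, map_C, h4, map_zero, zero_mul]
  have htaylor := subst_add_of_mul_self_eq_zero hY0 hE0 hE2 ((u.map σ).map π₄)
  -- pull the Taylor identity back to `O⟦X⟧` modulo `4`
  have hs1 : HasSubst (z ^ 2 + 2 * d) := HasSubst.of_constantCoeff_zero' (by
    rw [map_add, map_pow, hz, zero_pow two_ne_zero, zero_add, map_mul, hd0, mul_zero])
  have hs2 : HasSubst (z ^ 2) := HasSubst.of_constantCoeff_zero' (by rw [map_pow, hz, zero_pow two_ne_zero])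
  have hkey' : (phi σ (u.subst z)).map π₄
      = PowerSeries.map π₄ ((u.map σ).subst (z ^ 2) + (d⁄dX O (u.map σ)).subst (z ^ 2) * (2 * d)) := by
    conv_lhs => rw [phi_subst hz, hzφ, map_subst_apply' hs1, map_add (PowerSeries.map π₄) (z ^ 2) (2 * d),
      htaylor]
    conv_rhs => rw [map_add, map_mul (PowerSeries.map π₄) ((d⁄dX O (u.map σ)).subst (z ^ 2)) (2 * d),
      map_subst_apply' hs2, map_subst_apply' hs2, ← derivative_map']
  have hkey : PowerSeries.map π₄
      (phi σ (u.subst z) - ((u.map σ).subst (z ^ 2) + (d⁄dX O (u.map σ)).subst (z ^ 2) * (2 * d))) = 0 := by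
    rw [map_sub, hkey', sub_self]
  obtain ⟨R, hR⟩ := exists_eq_C_mul_of_map_mk_eq_zero (4 : O) hkey
  -- Step 2: `(σ_*u)(z²) = (φu)(z) = (u∘z)² + 2 δ∘z`
  have hsub : (u.map σ).subst (z ^ 2) = (u.subst z) ^ 2 + 2 * δ.subst z := by
    rw [map_subst_sq hz, hu, ← coe_substAlgHom hsz, map_add, map_pow, map_mul, map_ofNat]
  -- Step 3: cancel the `2`
  have hδ' : δ' = δ.subst z + (d⁄dX O (u.map σ)).subst (z ^ 2) * d + 2 * R := by
    have h2 : 2 * (δ' - (δ.subst z + (d⁄dX O (u.map σ)).subst (z ^ 2) * d + 2 * R)) = 0 := by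
      have := sub_eq_iff_eq_add.mp hR
      rw [h', hsub, show (C (4 : O) : O⟦X⟧) = 2 * 2 by
        rw [show (4 : O) = 2 * 2 by norm_num, map_mul, map_ofNat]] at this
      linear_combination this
    exact sub_eq_zero.mp (eq_zero_of_two_mul_eq_zero h2r h2)
  -- Step 4: reduce modulo `2` and use `(Frob_* ū)′(z̄²) = (ū′(z̄))²`
  have hzb0 : constantCoeff (z.map π) = 0 := constantCoeff_map_eq_zero π hz
  rw [hδ', map_add, map_add, map_two_mul hker, add_zero, map_subst_apply' hsz,
    map_mul (PowerSeries.map π) ((d⁄dX O (u.map σ)).subst (z ^ 2)) d, map_subst_apply' hs2, ← derivative_map',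
    map_map_apply', comp_eq_frobenius_comp hfrob, ← map_map_apply', map_pow,
    derivative_map_frobenius_subst_sq hzb0]

end ChainRule

/-! ### Cancellation: the class of a square vanishes -/

section Cancellation

variable {O : Type*} [CommRing O] {k : Type*} [CommRing k] [CharP k 2] [NoZeroDivisors k]
  {σ : O →+* O} {π : O →+* k}

/-- **Cancellation lemma.** If `c²·u = A²` in `O⟦X⟧` with `π_*c ≠ 0`, then the Dwork witness of `u` vanishes
mod `2`: `π_*δ = 0` whenever `φu = u² + 2δ`.  (For `c = 1`: the class of a square is `0`.)  Proof:
`φ(c)²φ(u) = φ(A)²` and `φ(x) ≡ x² (mod 2)` give `2c⁴δ ≡ 0 (mod 4)`. [K-UNIV.md §2 (CANCEL)] -/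
theorem map_delta_eq_zero_of_sq_mul_eq_sq (h2r : ∀ a : O, 2 * a = 0 → a = 0) (hker : ∀ a : O, π a = 0 ↔ ∃ b : O, a = 2 * b) (hfrob : ∀ a : O, π (σ a) = π a ^ 2) {c u A δ : O⟦X⟧}
    (h : c ^ 2 * u = A ^ 2) (hu : phi σ u = u ^ 2 + 2 * δ) (hc : c.map π ≠ 0) : δ.map π = 0 := by
  obtain ⟨δc, hδc⟩ := exists_delta hker hfrob c
  obtain ⟨δA, hδA⟩ := exists_delta hker hfrob A
  have hφ := congrArg (phi σ) h
  rw [phi_mul, phi_pow, phi_pow, hδc, hu, hδA] at hφ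
  have hA4 : A ^ 4 = c ^ 4 * u ^ 2 := by rw [show A ^ 4 = (A ^ 2) ^ 2 by ring, ← h]; ring
  -- `2 · (c⁴ δ - 2M) = 0`
  have h2 : 2 * (c ^ 4 * δ - 2 * (A ^ 2 * δA + δA ^ 2 - c ^ 2 * δc * u ^ 2 - 2 * c ^ 2 * δc * δ
      - δc ^ 2 * u ^ 2 - 2 * δc ^ 2 * δ)) = 0 := by
    linear_combination hφ + hA4
  have h3 := eq_zero_of_two_mul_eq_zero h2r h2
  have h4 : (c ^ 4 * δ).map π = 0 := by
    rw [sub_eq_zero.mp h3]; exact map_two_mul hker _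
  rw [map_mul, map_pow] at h4
  rcases mul_eq_zero.mp h4 with h5 | h5
  · exact absurd (pow_eq_zero_iff (by norm_num) |>.mp h5) hc
  · exact h5

end Cancellation

/-! ### THEOREM K, abstract core: transfer of the Kummer class along a common `2`-cover -/

section Transfer

variable {O : Type*} [CommRing O] {k : Type*} [CommRing k] [CharP k 2] [NoZeroDivisors k]
  {σ : O →+* O} {π : O →+* k}

/-- **The square relation.** If `c²·(u∘h) = A²` with `π_*c ≠ 0` (`h(0) = 0`, `φu = u² + 2δ`, `φh = h² + 2d`),
then `(π_*δ)∘h̄ = (ū′∘h̄)²·π_*d`. [K-UNIV.md §2 (SQ-rel)] -/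
theorem map_delta_subst_eq_of_sq (h2r : ∀ a : O, 2 * a = 0 → a = 0) (hker : ∀ a : O, π a = 0 ↔ ∃ b : O, a = 2 * b) (hfrob : ∀ a : O, π (σ a) = π a ^ 2) {u h c A δ d : O⟦X⟧}
    (hh0 : constantCoeff h = 0) (hu : phi σ u = u ^ 2 + 2 * δ) (hhφ : phi σ h = h ^ 2 + 2 * d)
    (hsq : c ^ 2 * u.subst h = A ^ 2) (hc : c.map π ≠ 0) :
    (δ.map π).subst (h.map π) = ((d⁄dX k (u.map π)).subst (h.map π)) ^ 2 * d.map π := by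
  obtain ⟨δ', hδ'⟩ := exists_delta hker hfrob (u.subst h)
  have h0 : δ'.map π = 0 := map_delta_eq_zero_of_sq_mul_eq_sq h2r hker hfrob hsq hδ' hc
  have hcr := chainRule h2r hker hfrob hh0 hu hhφ hδ'
  rw [h0, eq_comm] at hcr
  exact eq_of_add_eq_zero hcr

/-- **THEOREM K — abstract core (transfer of the Kummer class).**  Let `g, F ∈ O⟦X⟧` with Dwork witnesses
`δg, δF`, and `h ∈ XO⟦X⟧` with `π_*h ≠ 0`.  Suppose
* both `g∘h` and `F∘h` are squares up to cancellable factors: `cg²·(g∘h) = Ag²`, `cF²·(F∘h) = AF²` with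
  `π_*cg, π_*cF ≠ 0` (in the application `h = [2]_Ê`, `g∘[2]` is a square by the duplication formula and
  `F∘[2] = F²` for `F = exp(c·log_Ê)`);
* `g` and `F` have the same logarithmic derivative mod `2`: `ḡ′·F̄ = F̄′·ḡ` (both equal `ω̄`, the invariant
  differential, in the application).
Then for every `z ∈ XO⟦X⟧`, with `φ(g∘z) = (g∘z)² + 2δgz`, `φ(F∘z) = (F∘z)² + 2δFz`:
  `π_*δgz · (F̄∘z̄)² = π_*δFz · (ḡ∘z̄)²`,
i.e. the Dwork classes `D(g∘z) = D(F∘z)` coincide.  [K-UNIV.md §2 THEOREM K-core] -/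
theorem kummerClass_transfer (h2r : ∀ a : O, 2 * a = 0 → a = 0) (hker : ∀ a : O, π a = 0 ↔ ∃ b : O, a = 2 * b) (hfrob : ∀ a : O, π (σ a) = π a ^ 2) {g F h z cg Ag cF AF δg δF δgz δFz : O⟦X⟧}
    (hh0 : constantCoeff h = 0) (hhne : h.map π ≠ 0) (hz0 : constantCoeff z = 0)
    (hg : phi σ g = g ^ 2 + 2 * δg) (hF : phi σ F = F ^ 2 + 2 * δF)
    (hsqg : cg ^ 2 * g.subst h = Ag ^ 2) (hcg : cg.map π ≠ 0)
    (hsqF : cF ^ 2 * F.subst h = AF ^ 2) (hcF : cF.map π ≠ 0)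
    (hlog : d⁄dX k (g.map π) * F.map π = d⁄dX k (F.map π) * g.map π)
    (hgz : phi σ (g.subst z) = (g.subst z) ^ 2 + 2 * δgz)
    (hFz : phi σ (F.subst z) = (F.subst z) ^ 2 + 2 * δFz) :
    δgz.map π * (PowerSeries.map π (F.subst z)) ^ 2 = δFz.map π * (PowerSeries.map π (g.subst z)) ^ 2 := by
  obtain ⟨dh, hdh⟩ := exists_delta hker hfrob h
  obtain ⟨dz, hdz⟩ := exists_delta hker hfrob z
  have hsz : HasSubst z := HasSubst.of_constantCoeff_zero' hz0
  have hhb0 : constantCoeff (h.map π) = 0 := constantCoeff_map_eq_zero π hh0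
  have hzb0 : constantCoeff (z.map π) = 0 := constantCoeff_map_eq_zero π hz0
  have hshb : HasSubst (h.map π) := HasSubst.of_constantCoeff_zero' hhb0
  have hszb : HasSubst (z.map π) := HasSubst.of_constantCoeff_zero' hzb0
  -- the two square relations on the cover
  have hrg := map_delta_subst_eq_of_sq h2r hker hfrob hh0 hg hdh hsqg hcg
  have hrF := map_delta_subst_eq_of_sq h2r hker hfrob hh0 hF hdh hsqF hcF
  -- Eq. (T): `δ̄g · F̄² = δ̄F · ḡ²` — first after `∘h̄`, then by injectivity
  have hlogh : (d⁄dX k (g.map π)).subst (h.map π) * (F.map π).subst (h.map π)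
      = (d⁄dX k (F.map π)).subst (h.map π) * (g.map π).subst (h.map π) := by
    have := congrArg (fun f => f.subst (h.map π)) hlog
    simpa only [subst_mul hshb] using this
  have hTh : (δg.map π * F.map π ^ 2 - δF.map π * g.map π ^ 2).subst (h.map π) = 0 := by
    rw [subst_sub hshb, subst_mul hshb, subst_mul hshb, subst_pow hshb, subst_pow hshb, hrg, hrF]
    linear_combination (dh.map π) * ((d⁄dX k (g.map π)).subst (h.map π) * (F.map π).subst (h.map π)
      + (d⁄dX k (F.map π)).subst (h.map π) * (g.map π).subst (h.map π)) * hlogh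
  have hT : δg.map π * F.map π ^ 2 = δF.map π * g.map π ^ 2 :=
    sub_eq_zero.mp (eq_zero_of_subst_eq_zero hhb0 hhne hTh)
  -- at the point `z`: chain rule for both
  have hcg' := chainRule h2r hker hfrob hz0 hg hdz hgz
  have hcF' := chainRule h2r hker hfrob hz0 hF hdz hFz
  have hlogz : (d⁄dX k (g.map π)).subst (z.map π) * (F.map π).subst (z.map π)
      = (d⁄dX k (F.map π)).subst (z.map π) * (g.map π).subst (z.map π) := by
    have := congrArg (fun f => f.subst (z.map π)) hlog
    simpa only [subst_mul hszb] using this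
  have hTz : (δg.map π).subst (z.map π) * (F.map π).subst (z.map π) ^ 2
      = (δF.map π).subst (z.map π) * (g.map π).subst (z.map π) ^ 2 := by
    have := congrArg (fun f => f.subst (z.map π)) hT
    simpa only [subst_mul hszb, subst_pow hszb] using this
  rw [hcg', hcF', map_subst_apply' hsz, map_subst_apply' hsz]
  linear_combination hTz + (dz.map π) * ((d⁄dX k (g.map π)).subst (z.map π) * (F.map π).subst (z.map π)
      + (d⁄dX k (F.map π)).subst (z.map π) * (g.map π).subst (z.map π)) * hlogz

end Transfer

/-! ### The two intended instances of the setting -/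

section Instances

/-- **`(ℤ₂, id, ℤ₂ → 𝔽₂)` satisfies the three standing hypotheses.** [folklore] -/
theorem frobeniusLift_padicInt_two :
    (∀ a : ℤ_[2], 2 * a = 0 → a = 0) ∧
      (∀ a : ℤ_[2], PadicInt.toZMod a = 0 ↔ ∃ b : ℤ_[2], a = 2 * b) ∧
      (∀ a : ℤ_[2], PadicInt.toZMod (RingHom.id ℤ_[2] a) = PadicInt.toZMod a ^ 2) := by
  refine ⟨?_, ?_, ?_⟩
  · intro a ha
    rcases mul_eq_zero.mp ha with h | h
    · exact absurd h two_ne_zero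
    · exact h
  · intro a
    rw [← RingHom.mem_ker, PadicInt.ker_toZMod, PadicInt.maximalIdeal_eq_span_p,
      Ideal.mem_span_singleton']
    constructor
    · rintro ⟨b, hb⟩
      exact ⟨b, by rw [← hb, mul_comm]; norm_num⟩
    · rintro ⟨b, hb⟩
      exact ⟨b, by rw [hb, mul_comm]; norm_num⟩
  · intro a
    rw [RingHom.id_apply, ZMod.pow_card]

variable (k : Type*) [CommRing k] [CharP k 2] [PerfectRing k 2] [NoZeroDivisors k] [Nontrivial k]

/-- **`(W(k), Frobenius, W(k) → k)` satisfies the three standing hypotheses** for a perfect domain `k` of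
characteristic `2` (e.g. `k = 𝔽̄₂`: `V∘F = 2`, `F` bijective). [folklore] -/
theorem frobeniusLift_wittVector :
    (∀ a : WittVector 2 k, 2 * a = 0 → a = 0) ∧
      (∀ a : WittVector 2 k, WittVector.constantCoeff a = 0 ↔ ∃ b : WittVector 2 k, a = 2 * b) ∧
      (∀ a : WittVector 2 k, WittVector.constantCoeff (WittVector.frobenius a) =
        WittVector.constantCoeff a ^ 2) := by
  have h2 : ((2 : ℕ) : WittVector 2 k) = 2 := Nat.cast_ofNat
  refine ⟨?_, ?_, ?_⟩
  · intro a ha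
    rcases mul_eq_zero.mp ha with h | h
    · exfalso
      have h1 := WittVector.coeff_p_one (p := 2) (R := k)
      rw [h2, h] at h1
      simp at h1
    · exact h
  · intro a
    constructor
    · intro ha
      have ha0 : a.coeff 0 = 0 := by simpa using ha
      have hV : a = WittVector.verschiebung (a.shift 1) := by
        have := WittVector.eq_iterate_verschiebung (x := a) (n := 1) (fun i hi => by
          interval_cases i; exact ha0)
        simpa using this
      obtain ⟨y, hy⟩ := (WittVector.frobenius_bijective 2 k).2 (a.shift 1)
      refine ⟨y, ?_⟩
      rw [hV, ← hy, WittVector.verschiebung_frobenius, mul_comm, h2]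
    · rintro ⟨b, rfl⟩
      have h2k : (2 : k) = 0 := by simpa using CharP.cast_eq_zero k 2
      rw [map_mul, map_ofNat, h2k, zero_mul]
  · intro a
    simp [WittVector.coeff_frobenius_charP]

end Instances

end Summit.BirchSwinnertonDyer.BirchSwinnertonDyer.Theorems.DepletionAtTwo.KEta.Kernel

end
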